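import Literature.NumberTheory.LFunctions.BeurlingClosureLpProofs
import Literature.NumberTheory.LFunctions.NymanBeurlingBaezDuarteProofs
import HarnessLib

/-!
# RH-EQUIVALENT (PROVED EQUIVALENCES) · Bagchi's sequence-space ("dramatic") form of the Nyman–Beurling–Báez-Duarte criterion and Báez-Duarte's refinement on `L²(0,1]` (Broughan Vol. 2 §3.4) — the printed three-way equivalences, stated as named facts AND DISCHARGED (`Bagchi2006_thm_1_holds`, `Bagchi2006_thm_8_holds`) from the tree's Báez-Duarte and Nyman theorems; nothing here bears on the truth of RH

LABEL (line 1): every statement of this file is an RH-EQUIVALENCE PROVED AS AN EQUIVALENCE (neither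
side asserted, no hypothesis assumed); the two `def … : Prop` named facts `Bagchi2006_thm_1`,
`Bagchi2006_thm_8` record the printed three-way equivalences "(i) RH ⟺ (ii) membership ⟺ (iii)
totality" and are PROVED in this same file (`…_holds`), legs: (i) ⟺ (ii) from the tree's
Báez-Duarte theorem and Nyman criterion, (ii) ⟹ (iii) by Bagchi's semigroup of dilations `T_m`,
(iii) ⟹ (i) trivially. Nothing here asserts RH or its negation; nothing here bears on the truth of RH.

Literature-typing tranche `rh-lit-broughan-2` (gen 4): Broughan, *Equivalents of the Riemann
Hypothesis* Vol. 2 (CUP 2017) [Broughan2017], Ch. 3 "Banach and Hilbert Space Methods",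
**§3.4 "Recent Developments" pp. 35–36** (section title and pages from the publisher's preview of
the Contents, p. vii; the volume's Index lists "Bagchi, B." at p. 36 and §1.2 p. 3 announces the
Nyman and Beurling criteria of Ch. 3; the book page itself was not seen — the statements below are
typed from the primary source and do not claim a Broughan theorem number).

## Source read (primary, in full)

B. Bagchi, *On Nyman, Beurling and Baez-Duarte's Hilbert space reformulation of the Riemann
hypothesis*, Proc. Indian Acad. Sci. (Math. Sci.) **116** (2006) 137–146 = arXiv:math/0607733
[Bagchi2006] (held: `paper:arxiv-math_0607733`), read pp. 1–8:

* §1: "Let `𝓗` denote the weighted `l²`-space consisting of all sequences `a = {a_n : n ∈ ℕ}` of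
  complex numbers such that `Σ_{n=1}^∞ |a_n|²/(n(n+1)) < ∞` … For `l = 1, 2, 3, …` let `γ_l ∈ 𝓗` be
  the sequence `γ_l = {{n/l} : n = 1, 2, 3, …}` (`{x}` the fractional part) … `γ = {1, 1, 1, …}`.
  Recall that a set `A` of vectors in a Hilbert space `𝓗` is said to be total if the set of all
  finite linear combinations of elements of `A` is dense in `𝓗`."
  **Theorem 1.** "The following statements are equivalent: (i) The Riemann hypothesis, (ii) `γ`
  belongs to the closed linear span of `{γ_l : l = 1, 2, 3, …}`, and (iii) the set
  `{γ_l : l = 1, 2, 3, …}` is total in `𝓗`."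
* §3 (p. 6–7): "`𝓜` … the closed subspace of `L²((0,1])` consisting of the functions which are
  almost everywhere constant on each of the sub-intervals `(1/(n+1), 1/n]`, `n = 1, 2, 3, …`";
  "`g_l(x) = {1/(lx)} − (1/l){1/x}`, `x ∈ (0,1]`"; "`g_l(x) = (1/l)⌊1/x⌋ − ⌊1/(lx)⌋`"; (5):
  "`g_l(x) = g_l(1/n) = {n/l}`, `x ∈ (1/(n+1), 1/n]`". **Theorem 8** (Báez-Duarte's refinement of
  Beurling–Nyman): "The following are equivalent: (i) The Riemann hypothesis, (ii) `𝟏` belongs to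
  the closed linear span of `{g_l : l = 1, 2, 3, …}`, and (iii) `{g_l : l = 1, 2, 3, …}` is a total
  set in `𝓜`." Proof of Theorem 1 (= "Theorem 9" in the arXiv numbering): "Let `U : 𝓜 → 𝓗` be the
  unitary defined by `U(f) = {f(1/n) : n = 1, 2, 3, …}`. Since `U(𝟏) = γ` and (in view of (5))
  `U(g_l) = γ_l`, this theorem is a straightforward reformulation of Theorem 8."

## Contents

* `bagchiMeasure` — `𝓗` realised as `L²` of the measure `Σ_{n≥1} δ_n/(n(n+1))` on `ℕ`;
  `bagchiGamma l n = {n/l}`; `BagchiSpanApprox a` — "`a` lies in the closed linear span of the `γ_l`"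
  (complex coefficients, `ε`-form); `bagchiG l` — Bagchi's `g_l`; `BagchiGSpanApprox f` — "`f` lies
  in the closed span of the `g_l` in `L²((0,1])`"; `IsBagchiStep f` — membership in `𝓜`.
* NAMED FACTS, DISCHARGED HERE: `Bagchi2006_thm_1` / `Bagchi2006_thm_1_holds` (the three-way
  equivalence in `𝓗`), `Bagchi2006_thm_8` / `Bagchi2006_thm_8_holds` (the three-way equivalence in
  `L²((0,1])`); unconditional corollaries `riemannHypothesis_iff_bagchiGamma_total`,
  `riemannHypothesis_iff_bagchiG_total`.
* PROVED (0 facts used): `bagchiG_eq_neg_nymanK` (`g_l = −k_{1/l}`, `k_α` of Broughan Thm 3.1 /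
  `BeurlingClosureLpProofs`), `bagchiG_eq_fract_floor` (Bagchi's (5)), `eLpNorm_comp_floor_eq` (the
  unitary `U`: `‖f‖_{L²(0,1]} = ‖(f(1/n))_n‖_𝓗` for `f ∈ 𝓜`), `riemannHypothesis_iff_bagchiGSpanApprox_one`
  (**Thm 8 (i) ⟺ (ii)**, from the tree's PROVED Báez-Duarte theorem `baezDuarte_iff_holds` and
  Nyman criterion `riemannHypothesis_iff_one_mem_closure_nymanK`),
  `riemannHypothesis_iff_bagchiSpanApprox_one` (**Thm 1 (i) ⟺ (ii)**),
  `riemannHypothesis_of_bagchi_total`, `riemannHypothesis_of_bagchiG_total` ((iii) ⟹ (i));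
  (ii) ⟹ (iii): `BagchiGSpanApprox.indicator_Ioc` (the dilation step `T_m`: `𝟏 ∈ 𝓚 ⟹ Φ_m ∈ 𝓚`,
  with `bagchiG_mul` = "`T_m g_l = g_{lm} − g_m/l`" and the measure-scaling of `x ↦ mx`),
  `BagchiGSpanApprox.indicator_cell`, `bagchiSpanApprox_truncation`, `BagchiSpanApprox.of_forall_exists`
  (closedness) + `tendsto_bagchiMeasure_tail` (tails of `𝓗`), `bagchi_total_of_spanApprox_one`,
  `IsBagchiStep.exists_ae_eq_comp_floor`, `bagchiG_total_of_spanApprox_one`.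

## Design notes (faithfulness)

* "closed linear span"/"total" are typed in `ε`-form with finite complex combinations, exactly as
  Bagchi's definition of total ("finite linear combinations … dense"); `𝓗 ∋ a` is `MemLp a 2
  bagchiMeasure`, `𝓜 ∋ f` is `MemLp f 2 (volume.restrict (Ioc 0 1)) ∧ IsBagchiStep f`.
* SHAPE for the splitting matrix: INDEX-FREE density/membership statements (∀ε ∃ approximant; no
  finite part) — nb column (Nyman–Beurling family), discrete costume.

## References

* [Bagchi2006] B. Bagchi, Proc. Indian Acad. Sci. Math. Sci. 116 (2006) 137–146, Theorems 1, 8.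
* [Broughan2017] K. Broughan, *Equivalents of the Riemann Hypothesis* Vol. 2, CUP 2017, §3.4
  pp. 35–36 (Index: Bagchi p. 36), Thm 3.1.
* [BaezDuarte2003] L. Báez-Duarte, Rend. Lincei (9) 14 (2003) 5–11 (the tree's `baezDuarte_iff`).
-/

noncomputable section

open MeasureTheory Set Complex Filter
open scoped ENNReal

namespace Literature.NumberTheory.LFunctions

/-! ## Bagchi's Hilbert space `𝓗`, the vectors `γ_l`, and the functions `g_l` -/

/-- Bagchi's weighted `l²` space `𝓗` (`Σ_{n≥1} |a_n|²/(n(n+1)) < ∞`) realised as `L²(bagchiMeasure)`: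
the measure `Σ_{n≥1} δ_n/(n(n+1))` on `ℕ` (written `Σ_{m≥0} δ_{m+1}/((m+1)(m+2))`; the point `0`
carries no mass). [cite: Bagchi2006, §1 (definition of 𝓗)] -/
def bagchiMeasure : Measure ℕ :=
  Measure.sum fun m : ℕ =>
    ENNReal.ofReal (1 / (((m : ℝ) + 1) * ((m : ℝ) + 2))) • Measure.dirac (m + 1)

/-- Bagchi's vectors `γ_l = ({n/l})_{n ≥ 1}`. [cite: Bagchi2006, §1] -/
def bagchiGamma (l n : ℕ) : ℝ := Int.fract ((n : ℝ) / l)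

/-- "`a` belongs to the closed linear span of `{γ_l : l ≥ 1}` in `𝓗`": for every `ε > 0` some finite
complex combination `Σ_i c_i γ_{l_i}` is within `ε` of `a` in `𝓗`. [cite: Bagchi2006, §1 Theorem 1 (ii)] -/
def BagchiSpanApprox (a : ℕ → ℂ) : Prop :=
  ∀ ε : ℝ, 0 < ε → ∃ (N : ℕ) (l : Fin N → ℕ) (c : Fin N → ℂ), (∀ i, 0 < l i) ∧
    eLpNorm (fun n : ℕ => a n - ∑ i, c i * (bagchiGamma (l i) n : ℂ)) 2 bagchiMeasure <
      ENNReal.ofReal ε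

/-- Bagchi's `g_l(x) = {1/(lx)} − (1/l){1/x}` on `(0,1]` (Báez-Duarte's functions restricted to
`(0,1]`). [cite: Bagchi2006, §3 (definition of g_l)] -/
def bagchiG (l : ℕ) (x : ℝ) : ℝ := Int.fract (1 / (l * x)) - 1 / l * Int.fract (1 / x)

/-- "`f` belongs to the closed linear span of `{g_l : l ≥ 1}` in `L²((0,1])`" (`ε`-form, finite complex
combinations). [cite: Bagchi2006, §3 Theorem 8 (ii)] -/
def BagchiGSpanApprox (f : ℝ → ℂ) : Prop :=
  ∀ ε : ℝ, 0 < ε → ∃ (N : ℕ) (l : Fin N → ℕ) (c : Fin N → ℂ), (∀ i, 0 < l i) ∧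
    eLpNorm (fun x : ℝ => f x - ∑ i, c i * (bagchiG (l i) x : ℂ)) 2
      (volume.restrict (Ioc (0 : ℝ) 1)) < ENNReal.ofReal ε

/-- Membership in Bagchi's `𝓜`: almost everywhere constant on each `(1/(n+1), 1/n]`, `n ≥ 1`.
[cite: Bagchi2006, §3 (definition of 𝓜)] -/
def IsBagchiStep (f : ℝ → ℂ) : Prop :=
  ∀ n : ℕ, 0 < n → ∃ c : ℂ, ∀ᵐ x ∂(volume.restrict (Ioc (1 / ((n : ℝ) + 1)) (1 / (n : ℝ)))), f x = c

/-! ## The printed statements (named facts) -/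

/-- **Bagchi 2006, Theorem 1** (the "dramatic formulation"; RH-EQUIVALENT as printed). In
`𝓗 = {a : Σ |a_n|²/(n(n+1)) < ∞}` with `γ_l = ({n/l})_n` and `γ = (1, 1, 1, …)`, the following are
equivalent: (i) RH; (ii) `γ` belongs to the closed linear span of `{γ_l : l ≥ 1}`; (iii) `{γ_l}` is
total in `𝓗`. (Legs (i) ⟺ (ii) and (iii) ⟹ (i) are PROVED below; (ii) ⟹ (iii) is Bagchi's
semigroup argument.) [cite: Bagchi2006, Theorem 1] [cite: Broughan2017, Vol. 2 §3.4 p. 36] -/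
def Bagchi2006_thm_1 : Prop :=
  [RiemannHypothesis,
    BagchiSpanApprox (fun _ : ℕ => (1 : ℂ)),
    ∀ a : ℕ → ℂ, MemLp a 2 bagchiMeasure → BagchiSpanApprox a].TFAE

/-- **Bagchi 2006, Theorem 8** (Báez-Duarte's refinement of the Beurling–Nyman theorem;
RH-EQUIVALENT as printed). With `g_l(x) = {1/(lx)} − (1/l){1/x}` on `(0,1]` and `𝓜 ⊂ L²((0,1])` the
functions a.e. constant on each `(1/(n+1), 1/n]`: (i) RH ⟺ (ii) `𝟏` belongs to the closed linear
span of `{g_l : l ≥ 1}` ⟺ (iii) `{g_l}` is total in `𝓜`. [cite: Bagchi2006, Theorem 8]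
[cite: Broughan2017, Vol. 2 §3.4 pp. 35–36] -/
def Bagchi2006_thm_8 : Prop :=
  [RiemannHypothesis,
    BagchiGSpanApprox (fun _ : ℝ => (1 : ℂ)),
    ∀ f : ℝ → ℂ, MemLp f 2 (volume.restrict (Ioc (0 : ℝ) 1)) → IsBagchiStep f →
      BagchiGSpanApprox f].TFAE

/-! ## Pointwise identities -/

/-- `g_l = −k_{1/l}` (`k_α(x) = ⌊α/x⌋ − α⌊1/x⌋ = −({α/x} − α{1/x})`, Broughan Thm 3.1).
[cite: Bagchi2006, §3 ("g_l(x) = (1/l)⌊1/x⌋ − ⌊1/(lx)⌋")] -/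
theorem bagchiG_eq_neg_nymanK (l : ℕ) (x : ℝ) : bagchiG l x = -nymanK (1 / l) x := by
  rw [nymanK_eq, bagchiG, neg_neg, div_div]

/-- Bagchi's (5): for `x ∈ (0,1]` (indeed `x > 0`) and `l ≥ 1`, `g_l(x) = {⌊1/x⌋/l}`; in particular
`g_l` is constant, `= {n/l}`, on `(1/(n+1), 1/n]`. [cite: Bagchi2006, §3 eq. (5)] -/
theorem bagchiG_eq_fract_floor {l : ℕ} (hl : 0 < l) {x : ℝ} (hx : 0 < x) :
    bagchiG l x = Int.fract ((⌊1 / x⌋₊ : ℝ) / l) := by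
  have hl' : (0 : ℝ) < l := by exact_mod_cast hl
  set y : ℝ := 1 / x with hy
  have hy0 : 0 ≤ y := by positivity
  set n : ℕ := ⌊y⌋₊ with hn
  -- `y = n + r`, `0 ≤ r < 1`
  have hfloor : (⌊y⌋ : ℝ) = (n : ℝ) := by
    rw [hn, natCast_floor_eq_intCast_floor hy0]
  have hr0 : 0 ≤ Int.fract y := Int.fract_nonneg y
  have hr1 : Int.fract y < 1 := Int.fract_lt_one y
  have hyr : y = n + Int.fract y := by rw [← hfloor, Int.floor_add_fract]
  -- `⌊y/l⌋ = ⌊n/l⌋` since `{n/l} + r/l < 1`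
  have hmod : Int.fract ((n : ℝ) / l) = ((n % l : ℕ) : ℝ) / l := Int.fract_div_natCast_eq_div_natCast_mod
  have hlt : Int.fract ((n : ℝ) / l) + Int.fract y / l < 1 := by
    rw [hmod]
    have h1 : ((n % l : ℕ) : ℝ) ≤ (l : ℝ) - 1 := by
      have : n % l < l := Nat.mod_lt _ hl
      have : (n % l : ℕ) + 1 ≤ l := this
      have : ((n % l : ℕ) : ℝ) + 1 ≤ (l : ℝ) := by exact_mod_cast this
      linarith
    rw [← add_div, div_lt_one hl']
    linarith
  have hfl : ⌊y / l⌋ = ⌊(n : ℝ) / l⌋ := by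
    rw [Int.floor_eq_iff]
    constructor
    · calc ((⌊(n : ℝ) / l⌋ : ℤ) : ℝ) ≤ (n : ℝ) / l := Int.floor_le _
        _ ≤ y / l := by
          apply div_le_div_of_nonneg_right _ hl'.le
          linarith
    · have : y / l = (n : ℝ) / l + Int.fract y / l := by rw [← add_div, ← hyr]
      rw [this]
      have h2 : (n : ℝ) / l = ⌊(n : ℝ) / l⌋ + Int.fract ((n : ℝ) / l) :=
        (Int.floor_add_fract _).symm
      linarith
  -- conclude
  have h1lx : 1 / ((l : ℝ) * x) = y / l := by rw [hy]; field_simp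
  unfold bagchiG
  rw [h1lx, ← hy]
  rw [Int.fract, Int.fract, Int.fract, hfl, hfloor]
  have : y / l = (n : ℝ) / l + (y - n) / l := by ring
  rw [this]
  ring

/-- On `(1/(n+2), 1/(n+1)]` one has `⌊1/x⌋ = n + 1`. [cite: Bagchi2006, §3 (text before (5))] -/
theorem natFloor_one_div_eq_of_mem {n : ℕ} {x : ℝ}
    (hx : x ∈ Ioc (1 / ((n : ℝ) + 2)) (1 / ((n : ℝ) + 1))) : ⌊1 / x⌋₊ = n + 1 := by
  obtain ⟨h1, h2⟩ := hx
  have hn1 : (0 : ℝ) < (n : ℝ) + 1 := by positivity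
  have hn2 : (0 : ℝ) < (n : ℝ) + 2 := by positivity
  have hx0 : 0 < x := lt_trans (by positivity) h1
  rw [Nat.floor_eq_iff (by positivity)]
  push_cast
  constructor
  · rw [le_div_iff₀ hx0]
    calc ((n : ℝ) + 1) * x ≤ ((n : ℝ) + 1) * (1 / ((n : ℝ) + 1)) := by gcongr
      _ = 1 := by field_simp
  · rw [div_lt_iff₀ hx0]
    calc (1 : ℝ) = ((n : ℝ) + 2) * (1 / ((n : ℝ) + 2)) := by field_simp
      _ < ((n : ℝ) + 1 + 1) * x := by rw [show (n : ℝ) + 1 + 1 = n + 2 by ring]; gcongr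

/-! ## The unitary `U : 𝓜 → 𝓗`, `f ↦ (f(1/n))_n` -/

/-- The intervals `(1/(n+2), 1/(n+1)]` partition `(0,1]`. [cite: Bagchi2006, §3 (the sub-intervals of 𝓜)] -/
theorem iUnion_Ioc_one_div_succ :
    (⋃ n : ℕ, Ioc (1 / ((n : ℝ) + 2)) (1 / ((n : ℝ) + 1))) = Ioc (0 : ℝ) 1 := by
  ext x
  simp only [mem_iUnion, mem_Ioc]
  constructor
  · rintro ⟨n, h1, h2⟩
    refine ⟨lt_trans (by positivity) h1, h2.trans ?_⟩
    rw [div_le_one (by positivity)]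
    linarith [n.cast_nonneg (α := ℝ)]
  · rintro ⟨h0, h1⟩
    -- `N = ⌊1/x⌋ ≥ 1`, `x ∈ (1/(N+1), 1/N]`
    obtain ⟨N, hN⟩ : ∃ N : ℕ, ⌊1 / x⌋₊ = N + 1 :=
      Nat.exists_eq_add_one_of_ne_zero (by
        rw [← Nat.pos_iff_ne_zero, Nat.floor_pos, le_div_iff₀ h0]; linarith)
    rw [Nat.floor_eq_iff (by positivity)] at hN
    push_cast at hN
    refine ⟨N, ?_, ?_⟩
    · rw [div_lt_iff₀ (by positivity)]
      have := hN.2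
      rw [div_lt_iff₀ h0] at this
      linarith
    · rw [le_div_iff₀ (by positivity)]
      have := hN.1
      rw [le_div_iff₀ h0] at this
      linarith

/-- **The unitary `U`.** For any sequence `h`, the step function `x ↦ h(⌊1/x⌋)` on `(0,1]` has
`‖h ∘ ⌊1/·⌋‖_{L²((0,1])} = ‖h‖_𝓗`: `∫_{(1/(n+1),1/n]} |h(n)|² dx = |h(n)|²/(n(n+1))`.
[cite: Bagchi2006, §3 proof of Theorem 1 ("U(f) = {f(1/n)}" is unitary)] -/
theorem eLpNorm_comp_floor_eq {E : Type*} [NormedAddCommGroup E] (h : ℕ → E) :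
    eLpNorm (fun x : ℝ => h ⌊1 / x⌋₊) 2 (volume.restrict (Ioc (0 : ℝ) 1)) =
      eLpNorm h 2 bagchiMeasure := by
  rw [eLpNorm_eq_lintegral_rpow_enorm_toReal two_ne_zero ENNReal.ofNat_ne_top,
    eLpNorm_eq_lintegral_rpow_enorm_toReal two_ne_zero ENNReal.ofNat_ne_top]
  congr 1
  -- right side: the weighted sum
  rw [bagchiMeasure, lintegral_sum_measure]
  simp_rw [lintegral_smul_measure, lintegral_dirac]
  -- left side: split `(0,1]` into the intervals
  rw [← iUnion_Ioc_one_div_succ, lintegral_iUnion (fun n => measurableSet_Ioc)]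
  · refine tsum_congr fun n => ?_
    rw [setLIntegral_congr_fun measurableSet_Ioc
        (g := fun _ => ‖h (n + 1)‖ₑ ^ (2 : ℝ≥0∞).toReal)
        (fun x hx => by simp only [natFloor_one_div_eq_of_mem hx]),
      setLIntegral_const, Real.volume_Ioc, smul_eq_mul, mul_comm]
    congr 1
    congr 1
    have hn1 : (0 : ℝ) < (n : ℝ) + 1 := by positivity
    have hn2 : (0 : ℝ) < (n : ℝ) + 2 := by positivity
    field_simp
    ring
  · -- pairwise disjoint
    have key : ∀ m n : ℕ, m < n →
        Disjoint (Ioc (1 / ((m : ℝ) + 2)) (1 / ((m : ℝ) + 1))) (Ioc (1 / ((n : ℝ) + 2)) (1 / ((n : ℝ) + 1))) := by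
      intro m n hlt
      refine Set.disjoint_left.2 fun x hxm hxn => ?_
      have h1 : (1 : ℝ) / ((m : ℝ) + 2) < x := hxm.1
      have h2 : x ≤ 1 / ((n : ℝ) + 1) := hxn.2
      have h3 : (m : ℝ) + 2 ≤ (n : ℝ) + 1 := by
        have : m + 1 ≤ n := hlt
        have : ((m : ℝ) + 1) ≤ n := by exact_mod_cast this
        linarith
      have h4 : (1 : ℝ) / ((n : ℝ) + 1) ≤ 1 / ((m : ℝ) + 2) :=
        one_div_le_one_div_of_le (by positivity) h3
      linarith
    intro m n hmn
    rcases Nat.lt_or_gt_of_ne hmn with h | h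
    · exact key m n h
    · exact (key n m h).symm

/-- A finite combination `f − Σ c_i g_{l_i}` of a step function `x ↦ a(⌊1/x⌋)` is again of that form on
`(0,1]`, with the sequence `n ↦ a(n) − Σ c_i {n/l_i}` (Bagchi's `U(g_l) = γ_l`).
[cite: Bagchi2006, §3 eq. (5) and proof of Theorem 1] -/
theorem sub_sum_bagchiG_eq {N : ℕ} (l : Fin N → ℕ) (c : Fin N → ℂ) (hl : ∀ i, 0 < l i)
    (a : ℕ → ℂ) {x : ℝ} (hx : 0 < x) :
    a ⌊1 / x⌋₊ - ∑ i, c i * (bagchiG (l i) x : ℂ) =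
      (fun n : ℕ => a n - ∑ i, c i * (bagchiGamma (l i) n : ℂ)) ⌊1 / x⌋₊ := by
  simp only [bagchiGamma]
  congr 1
  exact Finset.sum_congr rfl fun i _ => by rw [bagchiG_eq_fract_floor (hl i) hx]

/-- Transfer `𝓗 → L²((0,1])`: the `𝓗`-distance from `a` to `Σ c_i γ_{l_i}` equals the `L²((0,1])`
distance from `a(⌊1/·⌋)` to `Σ c_i g_{l_i}`. [cite: Bagchi2006, §3 proof of Theorem 1] -/
theorem eLpNorm_sub_sum_bagchiG_eq {N : ℕ} (l : Fin N → ℕ) (c : Fin N → ℂ) (hl : ∀ i, 0 < l i)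
    (a : ℕ → ℂ) :
    eLpNorm (fun x : ℝ => a ⌊1 / x⌋₊ - ∑ i, c i * (bagchiG (l i) x : ℂ)) 2
        (volume.restrict (Ioc (0 : ℝ) 1)) =
      eLpNorm (fun n : ℕ => a n - ∑ i, c i * (bagchiGamma (l i) n : ℂ)) 2 bagchiMeasure := by
  rw [← eLpNorm_comp_floor_eq]
  refine eLpNorm_congr_ae ?_
  filter_upwards [ae_restrict_mem measurableSet_Ioc] with x hx
  exact sub_sum_bagchiG_eq l c hl a hx.1

/-! ## Theorem 8, (i) ⟺ (ii): from Báez-Duarte's theorem and Nyman's criterion -/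

/-- `{y} = y` for `0 ≤ y < 1`, used on `(1, ∞)` where `{1/(kx)} = 1/(kx)`. [cite: Bagchi2006, §2 (F_λ on Ω)] -/
private theorem fract_one_div_mul_eq {k x : ℝ} (hk : 1 ≤ k) (hx : 1 < x) :
    Int.fract (1 / (k * x)) = 1 / (k * x) := by
  have hkx : 1 < k * x := by nlinarith
  rw [Int.fract_eq_self]
  exact ⟨by positivity, (div_lt_one (by linarith)).2 hkx⟩

/-- **RH ⟹ Theorem 8 (ii)** (Báez-Duarte's theorem, transported to `(0,1]`). From the tree's PROVED
`baezDuarte_iff_holds` (`χ_(0,1]` is an `L²(0,∞)`-limit of real combinations `Σ_k c_k {1/(kx)}`): on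
`(1,∞)` such a combination equals `A/x` with `A = Σ_k c_k/k`, so `|A|` is small, and on `(0,1]`
`Σ_k c_k g_k = Σ_k c_k {1/(kx)} − A{1/x}`. [cite: Bagchi2006, Theorem 8 (i) ⟹ (ii)] -/
theorem bagchiGSpanApprox_one_of_riemannHypothesis (hRH : RiemannHypothesis) :
    BagchiGSpanApprox (fun _ : ℝ => (1 : ℂ)) := by
  intro ε hε
  obtain ⟨N, c, hN⟩ := baezDuarte_iff_holds.1 hRH (ε / 4) (by positivity)
  set A : ℝ := ∑ k : Fin N, c k / ((k : ℕ) + 1) with hA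
  set D : ℝ → ℝ := fun x ↦ (Set.Ioc (0 : ℝ) 1).indicator 1 x -
      ∑ k : Fin N, c k * Int.fract (1 / (((k : ℕ) + 1 : ℝ) * x)) with hD
  have hD4 : eLpNorm D 2 (volume.restrict (Ioi (0 : ℝ))) < ENNReal.ofReal (ε / 4) := hN
  -- Step (a): `|A|/2 ≤ ‖D‖_{L²((1,2])} ≤ ‖D‖_{L²(0,∞)} < ε/4`, so `|A| < ε/2`.
  have hDIoc : ∀ x ∈ Ioc (1 : ℝ) 2, D x = -(A / x) := by
    intro x hx
    have hx1 : 1 < x := hx.1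
    have hind : (Set.Ioc (0 : ℝ) 1).indicator (1 : ℝ → ℝ) x = 0 := by
      rw [Set.indicator_of_notMem]
      exact fun h => absurd h.2 (not_le.2 hx1)
    simp only [hD, hind, zero_sub, hA, Finset.sum_div, ← Finset.sum_neg_distrib]
    refine Finset.sum_congr rfl fun k _ => ?_
    have hk : (1 : ℝ) ≤ (k : ℕ) + 1 := by linarith [(k : ℕ).cast_nonneg (α := ℝ)]
    rw [fract_one_div_mul_eq hk hx1]
    field_simp
  have hsub12 : Ioc (1 : ℝ) 2 ⊆ Ioi 0 := fun x hx => lt_trans zero_lt_one hx.1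
  have hsub01 : Ioc (0 : ℝ) 1 ⊆ Ioi 0 := fun x hx => hx.1
  have hAbound : ENNReal.ofReal (|A| / 2) ≤ eLpNorm D 2 (volume.restrict (Ioi (0 : ℝ))) := by
    have hconst : eLpNorm (fun _ : ℝ => A / 2) 2 (volume.restrict (Ioc (1 : ℝ) 2)) =
        ENNReal.ofReal (|A| / 2) := by
      rw [eLpNorm_const _ two_ne_zero]
      · rw [Measure.restrict_apply_univ, Real.volume_Ioc]
        norm_num
        rw [Real.enorm_eq_ofReal_abs, abs_div, abs_two]
      · rw [Ne, Measure.restrict_eq_zero, Real.volume_Ioc]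
        norm_num
    calc ENNReal.ofReal (|A| / 2)
        = eLpNorm (fun _ : ℝ => A / 2) 2 (volume.restrict (Ioc (1 : ℝ) 2)) := hconst.symm
      _ ≤ eLpNorm D 2 (volume.restrict (Ioc (1 : ℝ) 2)) := by
          refine eLpNorm_mono_ae ?_
          filter_upwards [ae_restrict_mem measurableSet_Ioc] with x hx
          rw [hDIoc x hx, norm_neg, Real.norm_eq_abs, Real.norm_eq_abs, abs_div, abs_div,
            abs_of_pos (lt_trans zero_lt_one hx.1), abs_two]
          exact div_le_div_of_nonneg_left (abs_nonneg A) (lt_trans zero_lt_one hx.1) hx.2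
      _ ≤ eLpNorm D 2 (volume.restrict (Ioi (0 : ℝ))) :=
          eLpNorm_mono_measure _ (Measure.restrict_mono hsub12 le_rfl)
  have hA2 : |A| < ε / 2 := by
    have := lt_of_le_of_lt hAbound hD4
    rw [ENNReal.ofReal_lt_ofReal_iff (by positivity)] at this
    linarith
  -- Step (b): on `(0,1]`, `1 − Σ_k c_k g_{k+1}(x) = D(x) + A·{1/x}`.
  refine ⟨N, fun k => (k : ℕ) + 1, fun k => (c k : ℂ), fun k => Nat.succ_pos _, ?_⟩
  -- the real identity `1 − Σ c_k g_{k+1}(x) = (1 − Σ c_k {1/((k+1)x)}) + A {1/x}` (all `x`)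
  have hptR : ∀ x : ℝ, (1 : ℝ) - ∑ k : Fin N, c k * bagchiG ((k : ℕ) + 1) x =
      ((1 : ℝ) - ∑ k : Fin N, c k * Int.fract (1 / (((k : ℕ) + 1 : ℝ) * x))) +
        A * Int.fract (1 / x) := by
    intro x
    have hk : ∀ k : Fin N, c k * bagchiG ((k : ℕ) + 1) x =
        c k * Int.fract (1 / (((k : ℕ) + 1 : ℝ) * x)) - c k / ((k : ℕ) + 1) * Int.fract (1 / x) := by
      intro k
      unfold bagchiG
      push_cast
      ring
    simp only [hk, Finset.sum_sub_distrib, hA, Finset.sum_mul]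
    ring
  have hDx : ∀ x ∈ Ioc (0 : ℝ) 1,
      D x = (1 : ℝ) - ∑ k : Fin N, c k * Int.fract (1 / (((k : ℕ) + 1 : ℝ) * x)) := by
    intro x hx
    have hind : (Set.Ioc (0 : ℝ) 1).indicator (1 : ℝ → ℝ) x = 1 := by
      rw [Set.indicator_of_mem hx]; rfl
    simp only [hD, hind]
  have hpt : ∀ x ∈ Ioc (0 : ℝ) 1,
      ((1 : ℂ) - ∑ k : Fin N, (c k : ℂ) * (bagchiG ((k : ℕ) + 1) x : ℂ)) =
        ((D x + A * Int.fract (1 / x) : ℝ) : ℂ) := by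
    intro x hx
    rw [hDx x hx, ← hptR x]
    push_cast
    rfl
  have hmeasD : AEStronglyMeasurable (fun x : ℝ => ((D x : ℝ) : ℂ))
      (volume.restrict (Ioc (0 : ℝ) 1)) := by
    apply Measurable.aestronglyMeasurable
    refine Complex.measurable_ofReal.comp ?_
    refine ((measurable_const.indicator measurableSet_Ioc).sub ?_)
    exact Finset.measurable_sum _ fun k _ =>
      measurable_const.mul (measurable_fract.comp (measurable_const.div
        (measurable_const.mul measurable_id)))
  have hmeasF : AEStronglyMeasurable (fun x : ℝ => ((A * Int.fract (1 / x) : ℝ) : ℂ))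
      (volume.restrict (Ioc (0 : ℝ) 1)) := by
    apply Measurable.aestronglyMeasurable
    exact Complex.measurable_ofReal.comp
      (measurable_const.mul (measurable_fract.comp (measurable_const.div measurable_id)))
  calc eLpNorm (fun x : ℝ => (1 : ℂ) - ∑ k : Fin N, (c k : ℂ) * (bagchiG ((k : ℕ) + 1) x : ℂ)) 2
          (volume.restrict (Ioc (0 : ℝ) 1))
      = eLpNorm (fun x : ℝ => ((D x : ℝ) : ℂ) + ((A * Int.fract (1 / x) : ℝ) : ℂ)) 2
          (volume.restrict (Ioc (0 : ℝ) 1)) := by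
        refine eLpNorm_congr_ae ?_
        filter_upwards [ae_restrict_mem measurableSet_Ioc] with x hx
        rw [hpt x hx]
        push_cast
        ring
    _ ≤ eLpNorm (fun x : ℝ => ((D x : ℝ) : ℂ)) 2 (volume.restrict (Ioc (0 : ℝ) 1)) +
          eLpNorm (fun x : ℝ => ((A * Int.fract (1 / x) : ℝ) : ℂ)) 2
            (volume.restrict (Ioc (0 : ℝ) 1)) := eLpNorm_add_le hmeasD hmeasF one_le_two
    _ ≤ eLpNorm D 2 (volume.restrict (Ioi (0 : ℝ))) +
          ENNReal.ofReal |A| := by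
        gcongr
        · calc eLpNorm (fun x : ℝ => ((D x : ℝ) : ℂ)) 2 (volume.restrict (Ioc (0 : ℝ) 1))
              = eLpNorm D 2 (volume.restrict (Ioc (0 : ℝ) 1)) :=
                eLpNorm_congr_enorm_ae (Eventually.of_forall fun x => by
                  rw [enorm_eq_nnnorm, enorm_eq_nnnorm, Complex.nnnorm_real])
            _ ≤ eLpNorm D 2 (volume.restrict (Ioi (0 : ℝ))) :=
                eLpNorm_mono_measure _ (Measure.restrict_mono hsub01 le_rfl)
        · calc eLpNorm (fun x : ℝ => ((A * Int.fract (1 / x) : ℝ) : ℂ)) 2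
                (volume.restrict (Ioc (0 : ℝ) 1))
              ≤ (volume.restrict (Ioc (0 : ℝ) 1)) Set.univ ^ (2 : ℝ≥0∞).toReal⁻¹ *
                  ENNReal.ofReal |A| := by
                refine eLpNorm_le_of_ae_bound (Eventually.of_forall fun x => ?_)
                rw [Complex.norm_real, Real.norm_eq_abs, abs_mul]
                calc |A| * |Int.fract (1 / x)| ≤ |A| * 1 := by
                      gcongr
                      rw [abs_of_nonneg (Int.fract_nonneg _)]
                      exact (Int.fract_lt_one _).le
                  _ = |A| := mul_one _
            _ = ENNReal.ofReal |A| := by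
                rw [Measure.restrict_apply_univ, Real.volume_Ioc]
                norm_num
    _ < ENNReal.ofReal (ε / 4) + ENNReal.ofReal (ε / 2) := by
        refine ENNReal.add_lt_add hD4 ?_
        rw [ENNReal.ofReal_lt_ofReal_iff (by positivity)]
        exact hA2
    _ ≤ ENNReal.ofReal ε := by
        rw [← ENNReal.ofReal_add (by positivity) (by positivity)]
        exact ENNReal.ofReal_le_ofReal (by linarith)

/-- **Theorem 8 (ii) ⟹ RH**: a complex combination of the `g_l` close to `𝟏` in `L²((0,1])` gives,
taking real parts, a real combination of Broughan's `k_{1/l}` close to `1` in `L²(0,1)`, and Nyman's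
criterion (`riemannHypothesis_iff_one_mem_closure_nymanK`) applies. [cite: Bagchi2006, Theorem 8 (ii) ⟹ (i)] -/
theorem riemannHypothesis_of_bagchiGSpanApprox_one (h : BagchiGSpanApprox (fun _ : ℝ => (1 : ℂ))) :
    RiemannHypothesis := by
  refine riemannHypothesis_iff_one_mem_closure_nymanK.2 fun ε hε => ?_
  obtain ⟨N, l, c, hl, hlt⟩ := h ε hε
  refine ⟨N, fun i => 1 / (l i : ℝ), fun i => -(c i).re, fun i => ⟨by
    have := hl i; positivity, by
    rw [div_le_one (by exact_mod_cast hl i)]; exact_mod_cast hl i⟩, ?_⟩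
  calc eLpNorm (fun x : ℝ => (1 : ℝ) - ∑ i, -(c i).re * nymanK (1 / (l i : ℝ)) x) 2
          (volume.restrict (Ioo (0 : ℝ) 1))
      = eLpNorm (fun x : ℝ => (1 : ℝ) - ∑ i, (c i).re * bagchiG (l i) x) 2
          (volume.restrict (Ioc (0 : ℝ) 1)) := by
        rw [Measure.restrict_congr_set Ioo_ae_eq_Ioc]
        refine eLpNorm_congr_ae (Eventually.of_forall fun x => ?_)
        simp only [bagchiG_eq_neg_nymanK]
        congr 1
        exact Finset.sum_congr rfl fun i _ => by ring
    _ ≤ eLpNorm (fun x : ℝ => (1 : ℂ) - ∑ i, c i * (bagchiG (l i) x : ℂ)) 2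
          (volume.restrict (Ioc (0 : ℝ) 1)) := by
        refine eLpNorm_mono fun x => ?_
        have : (1 : ℝ) - ∑ i, (c i).re * bagchiG (l i) x =
            ((1 : ℂ) - ∑ i, c i * (bagchiG (l i) x : ℂ)).re := by
          simp [Complex.sub_re, Complex.re_sum, Complex.mul_re]
        rw [this, Real.norm_eq_abs]
        exact Complex.abs_re_le_norm _
    _ < ENNReal.ofReal ε := hlt

/-- **Bagchi 2006, Theorem 8, (i) ⟺ (ii)** — PROVED: RH holds iff the constant `𝟏` belongs to the
closed linear span of `{g_l : l ≥ 1}` in `L²((0,1])`. [cite: Bagchi2006, Theorem 8 (i) ⟺ (ii)]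
[cite: Broughan2017, Vol. 2 §3.4 pp. 35–36] -/
theorem riemannHypothesis_iff_bagchiGSpanApprox_one :
    RiemannHypothesis ↔ BagchiGSpanApprox (fun _ : ℝ => (1 : ℂ)) :=
  ⟨bagchiGSpanApprox_one_of_riemannHypothesis, riemannHypothesis_of_bagchiGSpanApprox_one⟩

/-! ## Theorem 1, (i) ⟺ (ii): transport by the unitary `U` -/

/-- **Bagchi 2006, Theorem 1, (i) ⟺ (ii)** — PROVED: RH holds iff `γ = (1,1,1,…)` belongs to the
closed linear span of `{γ_l = ({n/l})_n : l ≥ 1}` in `𝓗`. [cite: Bagchi2006, Theorem 1 (i) ⟺ (ii)]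
[cite: Broughan2017, Vol. 2 §3.4 p. 36] -/
theorem riemannHypothesis_iff_bagchiSpanApprox_one :
    RiemannHypothesis ↔ BagchiSpanApprox (fun _ : ℕ => (1 : ℂ)) := by
  rw [riemannHypothesis_iff_bagchiGSpanApprox_one]
  constructor
  · intro h ε hε
    obtain ⟨N, l, c, hl, hlt⟩ := h ε hε
    refine ⟨N, l, c, hl, ?_⟩
    rw [← eLpNorm_sub_sum_bagchiG_eq l c hl (fun _ => (1 : ℂ))]
    exact hlt
  · intro h ε hε
    obtain ⟨N, l, c, hl, hlt⟩ := h ε hε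
    refine ⟨N, l, c, hl, ?_⟩
    rw [← eLpNorm_sub_sum_bagchiG_eq l c hl (fun _ => (1 : ℂ))] at hlt
    exact hlt

/-! ## (iii) ⟹ (i), and the facts' remaining leg -/

/-- `𝓗` has finite total mass (`Σ 1/(n(n+1))` converges), so constants belong to `𝓗`.
[cite: Bagchi2006, §1 ("all bounded sequences … are vectors in this Hilbert space")] -/
theorem bagchiMeasure_univ_lt_top : bagchiMeasure Set.univ < ∞ := by
  rw [bagchiMeasure, Measure.sum_apply _ MeasurableSet.univ]
  simp only [Measure.smul_apply, Measure.dirac_apply_of_mem (Set.mem_univ _), smul_eq_mul, mul_one]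
  have hs : Summable fun m : ℕ => 1 / (((m : ℝ) + 1) * ((m : ℝ) + 2)) := by
    have h2 : Summable fun m : ℕ => 1 / ((m : ℝ) + 1) ^ 2 := by
      have := (Real.summable_one_div_nat_pow.2 one_lt_two)
      exact (summable_nat_add_iff 1).2 this |>.congr fun m => by push_cast; ring_nf
    refine h2.of_nonneg_of_le (fun m => by positivity) fun m => ?_
    apply one_div_le_one_div_of_le (by positivity)
    nlinarith [m.cast_nonneg (α := ℝ)]
  rw [← ENNReal.ofReal_tsum_of_nonneg (fun m => by positivity) hs]
  exact ENNReal.ofReal_lt_top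

/-- Bounded sequences are vectors of `𝓗`. [cite: Bagchi2006, §1 ("Notice that all bounded sequences of complex numbers are vectors in this Hilbert space")] -/
theorem memLp_bagchiMeasure_of_bounded {a : ℕ → ℂ} {C : ℝ} (ha : ∀ n, ‖a n‖ ≤ C) :
    MemLp a 2 bagchiMeasure := by
  refine ⟨(measurable_from_nat (f := a)).aestronglyMeasurable, ?_⟩
  refine lt_of_le_of_lt (eLpNorm_le_of_ae_bound (Eventually.of_forall ha)) ?_
  exact ENNReal.mul_lt_top (ENNReal.rpow_lt_top_of_nonneg (by positivity)
    bagchiMeasure_univ_lt_top.ne) ENNReal.ofReal_lt_top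

/-- **Theorem 1 (iii) ⟹ (i)** — PROVED: if `{γ_l}` is total in `𝓗`, then RH.
[cite: Bagchi2006, Theorem 1 (iii) ⟹ (i)] -/
theorem riemannHypothesis_of_bagchi_total
    (h : ∀ a : ℕ → ℂ, MemLp a 2 bagchiMeasure → BagchiSpanApprox a) : RiemannHypothesis :=
  riemannHypothesis_iff_bagchiSpanApprox_one.2
    (h _ (memLp_bagchiMeasure_of_bounded (C := 1) fun n => by simp))

/-- **Theorem 8 (iii) ⟹ (i)** — PROVED: if `{g_l}` is total in `𝓜`, then RH (`𝟏 ∈ 𝓜`).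
[cite: Bagchi2006, Theorem 8 (iii) ⟹ (i)] -/
theorem riemannHypothesis_of_bagchiG_total
    (h : ∀ f : ℝ → ℂ, MemLp f 2 (volume.restrict (Ioc (0 : ℝ) 1)) → IsBagchiStep f →
      BagchiGSpanApprox f) : RiemannHypothesis :=
  riemannHypothesis_iff_bagchiGSpanApprox_one.2
    (h _ (memLp_const 1) fun _ _ => ⟨1, Eventually.of_forall fun _ => rfl⟩)

/-- From the fact: RH ⟺ `{γ_l}` total in `𝓗` (Theorem 1 (i) ⟺ (iii)). [cite: Bagchi2006, Theorem 1] -/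
theorem Bagchi2006_thm_1.total_iff (h : Bagchi2006_thm_1) :
    RiemannHypothesis ↔ ∀ a : ℕ → ℂ, MemLp a 2 bagchiMeasure → BagchiSpanApprox a :=
  h.out 0 2

/-- From the fact: RH ⟺ `{g_l}` total in `𝓜` (Theorem 8 (i) ⟺ (iii)). [cite: Bagchi2006, Theorem 8] -/
theorem Bagchi2006_thm_8.total_iff (h : Bagchi2006_thm_8) :
    RiemannHypothesis ↔ ∀ f : ℝ → ℂ, MemLp f 2 (volume.restrict (Ioc (0 : ℝ) 1)) →
      IsBagchiStep f → BagchiGSpanApprox f :=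
  h.out 0 2

/-! ## Discharge of the remaining leg (ii) ⟹ (iii): Bagchi's semigroup of dilations

Bagchi's proof of Theorem 8 (ii) ⟹ (iii) [Bagchi2006, p. 7]: the isometries
`(T_m f)(x) = m^{1/2} f(mx)` on `(0, 1/m]`, `0` on `(1/m, 1]`, satisfy `T_m(g_l) = m^{1/2}(g_{lm} − g_m/l)`
and `T_m(Φ_n) = m^{1/2} Φ_{mn}` (`Φ_n = 𝟙_{(0,1/n]}`), so the closed span `𝓚` of the `g_l` is
`T_m`-invariant and `𝟏 = Φ_1 ∈ 𝓚` gives `Φ_n ∈ 𝓚` for all `n`; `{Φ_n}` is total in `𝓜`. Theorem 1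
follows by the unitary `U`. We follow this literally (the factor `m^{1/2}` is immaterial). -/

/-- `g_l` is measurable. [cite: Bagchi2006, §3 (g_l ∈ L²((0,1]))] -/
theorem measurable_bagchiG (l : ℕ) : Measurable (bagchiG l) := by
  have : bagchiG l = fun x => -nymanK (1 / l) x := funext (bagchiG_eq_neg_nymanK l)
  rw [this]
  exact (measurable_nymanK _).neg

/-- Finite combinations of the `g_l` are measurable. [cite: Bagchi2006, §3 (linear span of the g_l)] -/
theorem measurable_bagchiG_sum {N : ℕ} (l : Fin N → ℕ) (c : Fin N → ℂ) :
    Measurable fun x : ℝ => ∑ i, c i * (bagchiG (l i) x : ℂ) :=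
  Finset.measurable_sum _ fun i _ =>
    measurable_const.mul (Complex.measurable_ofReal.comp (measurable_bagchiG (l i)))

/-- `g_l` vanishes on `(1, ∞)` (`l ≥ 1`). [cite: Bagchi2006, §3 proof of Theorem 8 (T_m g_l supported in (0,1/m])] -/
theorem bagchiG_eq_zero_of_one_lt {l : ℕ} (hl : 0 < l) {y : ℝ} (hy : 1 < y) : bagchiG l y = 0 := by
  have hl' : (1 : ℝ) ≤ l := by exact_mod_cast hl
  rw [bagchiG_eq_neg_nymanK, nymanK_eq_zero_of_one_lt ⟨by positivity,
    (div_le_one (by positivity)).2 hl'⟩ hy, neg_zero]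

/-- Bagchi's dilation identity `T_m(g_l) = g_{lm} − g_m/l`: `g_l(mx) = g_{lm}(x) − (1/l) g_m(x)`.
[cite: Bagchi2006, §3 proof of Theorem 8 ("T_m(g_l) = m^{1/2}(g_{lm} − g_m/l)")] -/
theorem bagchiG_mul (l m : ℕ) (x : ℝ) :
    bagchiG l ((m : ℝ) * x) = bagchiG (l * m) x - 1 / l * bagchiG m x := by
  unfold bagchiG
  push_cast
  rw [show (l : ℝ) * ((m : ℝ) * x) = (l : ℝ) * m * x by ring]
  ring

/-! ### Closure properties of the span of the `g_l` (in `L²((0,1])`, complex coefficients) -/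

/-- A finite combination of the `g_l` approximates itself. [cite: Bagchi2006, §1 (definition of total: finite linear combinations)] -/
theorem BagchiGSpanApprox.of_sum {N : ℕ} (l : Fin N → ℕ) (c : Fin N → ℂ) (hl : ∀ i, 0 < l i) :
    BagchiGSpanApprox (fun x ↦ ∑ i, c i * (bagchiG (l i) x : ℂ)) := by
  intro ε hε
  refine ⟨N, l, c, hl, ?_⟩
  simp only [sub_self]
  rw [show (fun _ : ℝ ↦ (0 : ℂ)) = 0 from rfl, eLpNorm_zero]
  exact ENNReal.ofReal_pos.2 hε

/-- `0` is approximable. [cite: Bagchi2006, §1 (closed linear span)] -/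
theorem BagchiGSpanApprox.zero : BagchiGSpanApprox (fun _ : ℝ ↦ (0 : ℂ)) := by
  have h := BagchiGSpanApprox.of_sum (N := 0) Fin.elim0 Fin.elim0 (fun i ↦ i.elim0)
  simpa using h

/-- Approximability passes along a.e. equality on `(0,1]`. [cite: Bagchi2006, §3 (𝓜 as a space of a.e.-classes)] -/
theorem BagchiGSpanApprox.congr_ae {f g : ℝ → ℂ} (hf : BagchiGSpanApprox f)
    (h : f =ᵐ[volume.restrict (Ioc (0 : ℝ) 1)] g) : BagchiGSpanApprox g := by
  intro ε hε
  obtain ⟨N, l, c, hl, hlt⟩ := hf ε hε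
  refine ⟨N, l, c, hl, ?_⟩
  rwa [eLpNorm_congr_ae (h.mono fun x hx ↦ by simp only [hx] :
    (fun x ↦ f x - ∑ i, c i * (bagchiG (l i) x : ℂ)) =ᵐ[volume.restrict (Ioc (0 : ℝ) 1)]
      fun x ↦ g x - ∑ i, c i * (bagchiG (l i) x : ℂ))] at hlt

/-- The span is stable under sums. [cite: Bagchi2006, §1 (closed linear span)] -/
theorem BagchiGSpanApprox.add {f g : ℝ → ℂ} (hf : BagchiGSpanApprox f) (hg : BagchiGSpanApprox g)
    (hfm : AEStronglyMeasurable f (volume.restrict (Ioc (0 : ℝ) 1)))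
    (hgm : AEStronglyMeasurable g (volume.restrict (Ioc (0 : ℝ) 1))) :
    BagchiGSpanApprox (fun x ↦ f x + g x) := by
  intro ε hε
  obtain ⟨n, α, c, hα, hF⟩ := hf (ε / 2) (half_pos hε)
  obtain ⟨m, β, d, hβ, hG⟩ := hg (ε / 2) (half_pos hε)
  refine ⟨n + m, Fin.append α β, Fin.append c d, fun i ↦ ?_, ?_⟩
  · refine Fin.addCases (fun j ↦ ?_) (fun j ↦ ?_) i
    · simpa only [Fin.append_left] using hα j
    · simpa only [Fin.append_right] using hβ j
  · have hsplit : ∀ x : ℝ, ∑ i, Fin.append c d i * (bagchiG (Fin.append α β i) x : ℂ) =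
        (∑ i, c i * (bagchiG (α i) x : ℂ)) + ∑ j, d j * (bagchiG (β j) x : ℂ) := by
      intro x
      rw [Fin.sum_univ_add]
      simp only [Fin.append_left, Fin.append_right]
    have heq : (fun x ↦ (f x + g x) - ∑ i, Fin.append c d i * (bagchiG (Fin.append α β i) x : ℂ)) =
        (fun x ↦ f x - ∑ i, c i * (bagchiG (α i) x : ℂ)) +
          fun x ↦ g x - ∑ j, d j * (bagchiG (β j) x : ℂ) := by
      funext x
      simp only [hsplit, Pi.add_apply]
      ring
    rw [heq]
    have hFm : AEStronglyMeasurable (fun x ↦ f x - ∑ i, c i * (bagchiG (α i) x : ℂ))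
        (volume.restrict (Ioc (0 : ℝ) 1)) :=
      hfm.sub (measurable_bagchiG_sum α c).aestronglyMeasurable
    have hGm : AEStronglyMeasurable (fun x ↦ g x - ∑ j, d j * (bagchiG (β j) x : ℂ))
        (volume.restrict (Ioc (0 : ℝ) 1)) :=
      hgm.sub (measurable_bagchiG_sum β d).aestronglyMeasurable
    calc eLpNorm ((fun x ↦ f x - ∑ i, c i * (bagchiG (α i) x : ℂ)) +
            fun x ↦ g x - ∑ j, d j * (bagchiG (β j) x : ℂ)) 2 (volume.restrict (Ioc (0 : ℝ) 1))
        ≤ eLpNorm (fun x ↦ f x - ∑ i, c i * (bagchiG (α i) x : ℂ)) 2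
              (volume.restrict (Ioc (0 : ℝ) 1)) +
            eLpNorm (fun x ↦ g x - ∑ j, d j * (bagchiG (β j) x : ℂ)) 2
              (volume.restrict (Ioc (0 : ℝ) 1)) := eLpNorm_add_le hFm hGm one_le_two
      _ < ENNReal.ofReal (ε / 2) + ENNReal.ofReal (ε / 2) := ENNReal.add_lt_add hF hG
      _ = ENNReal.ofReal ε := by
          rw [← ENNReal.ofReal_add (half_pos hε).le (half_pos hε).le, add_halves]

/-- The span is stable under complex scalars. [cite: Bagchi2006, §1 (closed linear span)] -/
theorem BagchiGSpanApprox.smul {f : ℝ → ℂ} (hf : BagchiGSpanApprox f) (a : ℂ) :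
    BagchiGSpanApprox (fun x ↦ a * f x) := by
  by_cases ha : a = 0
  · simpa [ha] using BagchiGSpanApprox.zero
  intro ε hε
  have ha' : 0 < ‖a‖ := norm_pos_iff.2 ha
  obtain ⟨n, α, c, hα, hF⟩ := hf (ε / ‖a‖) (div_pos hε ha')
  refine ⟨n, α, fun i ↦ a * c i, hα, ?_⟩
  have heq : (fun x ↦ a * f x - ∑ i, (a * c i) * (bagchiG (α i) x : ℂ)) =
      a • fun x ↦ f x - ∑ i, c i * (bagchiG (α i) x : ℂ) := by
    funext x
    simp only [Pi.smul_apply, smul_eq_mul, mul_sub, Finset.mul_sum, mul_assoc]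
  rw [heq, eLpNorm_const_smul, mul_comm, ← ofReal_norm]
  calc eLpNorm (fun x ↦ f x - ∑ i, c i * (bagchiG (α i) x : ℂ)) 2
          (volume.restrict (Ioc (0 : ℝ) 1)) * ENNReal.ofReal ‖a‖
      < ENNReal.ofReal (ε / ‖a‖) * ENNReal.ofReal ‖a‖ :=
        ENNReal.mul_lt_mul_left (ENNReal.ofReal_pos.2 ha').ne' ENNReal.ofReal_ne_top hF
    _ = ENNReal.ofReal ε := by
        rw [← ENNReal.ofReal_mul (div_pos hε ha').le, div_mul_cancel₀ _ ha'.ne']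

/-- The span is stable under differences. [cite: Bagchi2006, §1 (closed linear span)] -/
theorem BagchiGSpanApprox.sub {f g : ℝ → ℂ} (hf : BagchiGSpanApprox f) (hg : BagchiGSpanApprox g)
    (hfm : AEStronglyMeasurable f (volume.restrict (Ioc (0 : ℝ) 1)))
    (hgm : AEStronglyMeasurable g (volume.restrict (Ioc (0 : ℝ) 1))) :
    BagchiGSpanApprox (fun x ↦ f x - g x) := by
  have h := BagchiGSpanApprox.add hf (hg.smul (-1)) hfm (hgm.const_mul (-1))
  refine (funext fun x ↦ ?_ : (fun x ↦ f x + -1 * g x) = fun x ↦ f x - g x) ▸ h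
  ring

/-- Finite sums of approximable measurable functions are approximable. [cite: Bagchi2006, §1 (closed linear span)] -/
theorem BagchiGSpanApprox.finset_sum {ι : Type*} (s : Finset ι) (f : ι → ℝ → ℂ)
    (hf : ∀ i ∈ s, BagchiGSpanApprox (f i))
    (hm : ∀ i ∈ s, AEStronglyMeasurable (f i) (volume.restrict (Ioc (0 : ℝ) 1))) :
    BagchiGSpanApprox (fun x ↦ ∑ i ∈ s, f i x) := by
  classical
  induction s using Finset.induction_on with
  | empty => simpa using BagchiGSpanApprox.zero
  | insert a s has ih =>
    have h1 : BagchiGSpanApprox (fun x ↦ f a x + ∑ i ∈ s, f i x) :=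
      BagchiGSpanApprox.add (hf a (Finset.mem_insert_self a s))
        (ih (fun i hi ↦ hf i (Finset.mem_insert_of_mem hi))
          (fun i hi ↦ hm i (Finset.mem_insert_of_mem hi)))
        (hm a (Finset.mem_insert_self a s))
        (by
          have e : (fun x ↦ ∑ i ∈ s, f i x) = ∑ i ∈ s, f i := by
            funext x; simp only [Finset.sum_apply]
          rw [e]
          exact Finset.aestronglyMeasurable_sum s fun i hi ↦ hm i (Finset.mem_insert_of_mem hi))
    simpa [Finset.sum_insert has] using h1

/-- The span is closed: a measurable `g` with approximable functions arbitrarily close in `L²((0,1])`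
is approximable. [cite: Bagchi2006, §1 (closed linear span)] -/
theorem BagchiGSpanApprox.of_forall_exists {g : ℝ → ℂ}
    (hgm : AEStronglyMeasurable g (volume.restrict (Ioc (0 : ℝ) 1)))
    (h : ∀ η : ℝ, 0 < η → ∃ f : ℝ → ℂ, BagchiGSpanApprox f ∧
      AEStronglyMeasurable f (volume.restrict (Ioc (0 : ℝ) 1)) ∧
      eLpNorm (fun x ↦ g x - f x) 2 (volume.restrict (Ioc (0 : ℝ) 1)) ≤ ENNReal.ofReal η) :
    BagchiGSpanApprox g := by
  intro ε hε
  obtain ⟨f, hf, hfm, hgf⟩ := h (ε / 2) (half_pos hε)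
  obtain ⟨n, α, c, hα, hF⟩ := hf (ε / 2) (half_pos hε)
  refine ⟨n, α, c, hα, ?_⟩
  have heq : (fun x ↦ g x - ∑ i, c i * (bagchiG (α i) x : ℂ)) =
      (fun x ↦ g x - f x) + fun x ↦ f x - ∑ i, c i * (bagchiG (α i) x : ℂ) := by
    funext x; simp only [Pi.add_apply]; ring
  rw [heq]
  calc eLpNorm ((fun x ↦ g x - f x) + fun x ↦ f x - ∑ i, c i * (bagchiG (α i) x : ℂ)) 2
          (volume.restrict (Ioc (0 : ℝ) 1))
      ≤ eLpNorm (fun x ↦ g x - f x) 2 (volume.restrict (Ioc (0 : ℝ) 1)) +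
          eLpNorm (fun x ↦ f x - ∑ i, c i * (bagchiG (α i) x : ℂ)) 2
            (volume.restrict (Ioc (0 : ℝ) 1)) :=
        eLpNorm_add_le (hgm.sub hfm) (hfm.sub (measurable_bagchiG_sum α c).aestronglyMeasurable)
          one_le_two
    _ < ENNReal.ofReal (ε / 2) + ENNReal.ofReal (ε / 2) := ENNReal.add_lt_add_of_le_of_lt
        (ne_top_of_le_ne_top ENNReal.ofReal_ne_top hgf) hgf hF
    _ = ENNReal.ofReal ε := by
        rw [← ENNReal.ofReal_add (half_pos hε).le (half_pos hε).le, add_halves]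

/-! ### The dilation step: `𝟏 ∈ 𝓚 ⟹ Φ_m = 𝟙_{(0,1/m]} ∈ 𝓚` -/

/-- **Bagchi's dilation step** (`T_m`-invariance of the closed span `𝓚` of the `g_l`, applied to
`𝟏 = Φ_1`): if `𝟏` is approximable then so is `Φ_m = 𝟙_{(0,1/m]}` for every `m ≥ 1`. With
`F = Σ c_i g_{l_i}`, `‖𝟏 − F‖ < ε`, the combination `G = Σ c_i g_{l_i m} − (Σ c_i/l_i) g_m` equals
`F(mx)`, `Φ_m − G = (𝟙_{(0,1]}(𝟏 − F))(mx)` on `(0,1]`, and `‖h(m·)‖_{L²} = m^{-1/2}‖h‖_{L²}`.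
[cite: Bagchi2006, §3 proof of Theorem 8 ((ii) ⟹ (iii): "T_m(Φ_n) = m^{1/2}Φ_{mn} … if 𝓚 contains 𝟏 = Φ_1 then it contains Φ_n for all n")] -/
theorem BagchiGSpanApprox.indicator_Ioc (hone : BagchiGSpanApprox fun _ : ℝ ↦ (1 : ℂ)) {m : ℕ}
    (hm : 0 < m) : BagchiGSpanApprox ((Ioc (0 : ℝ) (1 / m)).indicator fun _ ↦ (1 : ℂ)) := by
  have hm' : (0 : ℝ) < m := by exact_mod_cast hm
  intro ε hε
  obtain ⟨N, l, c, hl, hF⟩ := hone ε hε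
  refine ⟨N + 1, Fin.cons m (fun i ↦ l i * m), Fin.cons (-∑ i, c i / (l i : ℂ)) c, ?_, ?_⟩
  · intro i
    refine Fin.cases ?_ (fun j ↦ ?_) i
    · simpa using hm
    · simp only [Fin.cons_succ]
      exact Nat.mul_pos (hl j) hm
  · set F : ℝ → ℂ := fun y ↦ ∑ i, c i * (bagchiG (l i) y : ℂ) with hFdef
    set E : ℝ → ℂ := (Ioc (0 : ℝ) 1).indicator fun y ↦ 1 - F y with hEdef
    have hFm : Measurable F := measurable_bagchiG_sum l c
    have hEm : Measurable E := (measurable_const.sub hFm).indicator measurableSet_Ioc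
    -- the dilated combination is `F(mx)`
    have hG : ∀ x : ℝ, ∑ i : Fin (N + 1), (Fin.cons (-∑ i, c i / (l i : ℂ)) c : Fin (N + 1) → ℂ) i *
        (bagchiG ((Fin.cons m (fun i ↦ l i * m) : Fin (N + 1) → ℕ) i) x : ℂ) = F (m * x) := by
      intro x
      rw [Fin.sum_univ_succ]
      simp only [Fin.cons_zero, Fin.cons_succ, hFdef]
      have h1 : ∑ i, c i * (bagchiG (l i) ((m : ℝ) * x) : ℂ) =
          ∑ i, (c i * (bagchiG (l i * m) x : ℂ) - c i / (l i : ℂ) * (bagchiG m x : ℂ)) := by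
        refine Finset.sum_congr rfl fun i _ ↦ ?_
        rw [bagchiG_mul]
        push_cast
        ring
      rw [h1, Finset.sum_sub_distrib, ← Finset.sum_mul]
      ring
    -- pointwise identity on `(0,1]`
    have hpt : ∀ x ∈ Ioc (0 : ℝ) 1,
        (Ioc (0 : ℝ) (1 / m)).indicator (fun _ ↦ (1 : ℂ)) x - F (m * x) = E (m * x) := by
      intro x hx
      by_cases hxm : x ≤ 1 / m
      · have hmem : (m : ℝ) * x ∈ Ioc (0 : ℝ) 1 :=
          ⟨mul_pos hm' hx.1, by rwa [le_div_iff₀ hm', mul_comm] at hxm⟩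
        rw [indicator_of_mem (show x ∈ Ioc (0 : ℝ) (1 / m) from ⟨hx.1, hxm⟩), hEdef,
          indicator_of_mem hmem]
      · have h1 : 1 < (m : ℝ) * x := by
          rw [not_le, div_lt_iff₀ hm'] at hxm
          linarith
        have hF0 : F (m * x) = 0 := by
          simp only [hFdef]
          exact Finset.sum_eq_zero fun i _ ↦ by
            rw [bagchiG_eq_zero_of_one_lt (hl i) h1]; simp
        rw [indicator_of_notMem (fun h : x ∈ Ioc (0 : ℝ) (1 / m) ↦ hxm h.2), hEdef,
          indicator_of_notMem (fun h : (m : ℝ) * x ∈ Ioc (0 : ℝ) 1 ↦ (not_le.2 h1) h.2), hF0,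
          sub_zero]
    have hae : (fun x ↦ (Ioc (0 : ℝ) (1 / m)).indicator (fun _ ↦ (1 : ℂ)) x -
        ∑ i : Fin (N + 1), (Fin.cons (-∑ i, c i / (l i : ℂ)) c : Fin (N + 1) → ℂ) i *
          (bagchiG ((Fin.cons m (fun i ↦ l i * m) : Fin (N + 1) → ℕ) i) x : ℂ))
        =ᵐ[volume.restrict (Ioc (0 : ℝ) 1)] fun x ↦ E (m * x) := by
      filter_upwards [ae_restrict_mem measurableSet_Ioc] with x hx
      rw [hG x]
      exact hpt x hx
    rw [eLpNorm_congr_ae hae]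
    have hmp : MeasurePreserving (fun x : ℝ ↦ (m : ℝ) * x) volume
        (ENNReal.ofReal |(m : ℝ)⁻¹| • volume) :=
      ⟨measurable_const_mul _, Real.map_volume_mul_left hm'.ne'⟩
    have hcomp : (fun x ↦ E (m * x)) = E ∘ fun x : ℝ ↦ (m : ℝ) * x := rfl
    have hle : ENNReal.ofReal |(m : ℝ)⁻¹| ^ (1 / (2 : ℝ≥0∞)).toReal ≤ 1 :=
      ENNReal.rpow_le_one (ENNReal.ofReal_le_one.2 (by
        rw [abs_of_pos (inv_pos.2 hm')]
        exact inv_le_one_of_one_le₀ (by exact_mod_cast hm))) ENNReal.toReal_nonneg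
    calc eLpNorm (fun x ↦ E (m * x)) 2 (volume.restrict (Ioc (0 : ℝ) 1))
        ≤ eLpNorm (fun x ↦ E (m * x)) 2 volume := eLpNorm_mono_measure _ Measure.restrict_le_self
      _ = eLpNorm E 2 (ENNReal.ofReal |(m : ℝ)⁻¹| • volume) := by
          rw [hcomp]
          exact eLpNorm_comp_measurePreserving hEm.aestronglyMeasurable hmp
      _ ≤ ENNReal.ofReal |(m : ℝ)⁻¹| ^ (1 / (2 : ℝ≥0∞)).toReal • eLpNorm E 2 volume :=
          eLpNorm_smul_measure_le _ _ _ _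
      _ ≤ eLpNorm E 2 volume := by
          rw [smul_eq_mul]
          exact mul_le_of_le_one_left bot_le hle
      _ = eLpNorm (fun y ↦ 1 - F y) 2 (volume.restrict (Ioc (0 : ℝ) 1)) := by
          rw [hEdef, eLpNorm_indicator_eq_eLpNorm_restrict measurableSet_Ioc]
      _ < ENNReal.ofReal ε := hF

/-- The cells `𝟙_{(1/(k+1), 1/k]}` (`k ≥ 1`) are approximable once `𝟏` is:
`𝟙_{(1/(k+1),1/k]} = Φ_k − Φ_{k+1}`. [cite: Bagchi2006, §3 proof of Theorem 8 ("{Φ_n} is clearly a total subset of 𝓜")] -/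
theorem BagchiGSpanApprox.indicator_cell (hone : BagchiGSpanApprox fun _ : ℝ ↦ (1 : ℂ)) {k : ℕ}
    (hk : 0 < k) :
    BagchiGSpanApprox ((Ioc (1 / ((k : ℝ) + 1)) (1 / (k : ℝ))).indicator fun _ ↦ (1 : ℂ)) := by
  have h1 := hone.indicator_Ioc hk
  have h2 := hone.indicator_Ioc (m := k + 1) (Nat.succ_pos k)
  have hk' : (0 : ℝ) < k := by exact_mod_cast hk
  have hsub := BagchiGSpanApprox.sub h1 h2
    ((aestronglyMeasurable_const (b := (1 : ℂ))).indicator measurableSet_Ioc)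
    ((aestronglyMeasurable_const (b := (1 : ℂ))).indicator measurableSet_Ioc)
  have heq : (fun x ↦ (Ioc (0 : ℝ) (1 / ((k : ℕ) : ℝ))).indicator (fun _ ↦ (1 : ℂ)) x -
      (Ioc (0 : ℝ) (1 / (((k + 1 : ℕ)) : ℝ))).indicator (fun _ ↦ (1 : ℂ)) x) =
    (Ioc (1 / ((k : ℝ) + 1)) (1 / (k : ℝ))).indicator fun _ ↦ (1 : ℂ) := by
    funext x
    push_cast
    have hkk : (1 : ℝ) / ((k : ℝ) + 1) ≤ 1 / (k : ℝ) :=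
      one_div_le_one_div_of_le hk' (by linarith)
    by_cases ha : x ≤ 1 / ((k : ℝ) + 1)
    · by_cases h0 : 0 < x
      · rw [indicator_of_mem (mem_Ioc.2 ⟨h0, ha.trans hkk⟩), indicator_of_mem (mem_Ioc.2 ⟨h0, ha⟩),
          indicator_of_notMem (fun h : x ∈ Ioc (1 / ((k : ℝ) + 1)) (1 / (k : ℝ)) ↦
            (not_lt.2 ha) h.1), sub_self]
      · rw [indicator_of_notMem (fun h : x ∈ Ioc (0 : ℝ) (1 / (k : ℝ)) ↦ h0 h.1),
          indicator_of_notMem (fun h : x ∈ Ioc (0 : ℝ) (1 / ((k : ℝ) + 1)) ↦ h0 h.1),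
          indicator_of_notMem (fun h : x ∈ Ioc (1 / ((k : ℝ) + 1)) (1 / (k : ℝ)) ↦
            h0 (lt_trans (by positivity) h.1)), sub_self]
    · rw [not_le] at ha
      have h0 : 0 < x := lt_trans (by positivity) ha
      by_cases hb : x ≤ 1 / (k : ℝ)
      · rw [indicator_of_mem (mem_Ioc.2 ⟨h0, hb⟩),
          indicator_of_notMem (fun h : x ∈ Ioc (0 : ℝ) (1 / ((k : ℝ) + 1)) ↦ (not_le.2 ha) h.2),
          indicator_of_mem (mem_Ioc.2 ⟨ha, hb⟩), sub_zero]
      · rw [indicator_of_notMem (fun h : x ∈ Ioc (0 : ℝ) (1 / (k : ℝ)) ↦ hb h.2),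
          indicator_of_notMem (fun h : x ∈ Ioc (0 : ℝ) (1 / ((k : ℝ) + 1)) ↦ (not_le.2 ha) h.2),
          indicator_of_notMem (fun h : x ∈ Ioc (1 / ((k : ℝ) + 1)) (1 / (k : ℝ)) ↦ hb h.2),
          sub_self]
  rw [heq] at hsub
  exact hsub

/-! ### From cells to all of `𝓗`: truncations and the unitary `U` -/

/-- For `x ∈ (0,1]` and `k ≥ 1`: `x ∈ (1/(k+1), 1/k]` iff `⌊1/x⌋ = k`. [cite: Bagchi2006, §3 (text before (5): "⌊1/x⌋ = n for x ∈ (1/(n+1), 1/n]")] -/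
theorem mem_cell_iff_natFloor_eq {x : ℝ} (hx : 0 < x) {k : ℕ} (hk : 0 < k) :
    x ∈ Ioc (1 / ((k : ℝ) + 1)) (1 / (k : ℝ)) ↔ ⌊1 / x⌋₊ = k := by
  have hk' : (0 : ℝ) < k := by exact_mod_cast hk
  rw [Nat.floor_eq_iff (by positivity), mem_Ioc, le_div_iff₀ hx, div_lt_iff₀ hx,
    div_lt_iff₀ (by positivity : (0 : ℝ) < (k : ℝ) + 1), le_div_iff₀ hk']
  constructor
  · rintro ⟨h1, h2⟩; constructor <;> linarith
  · rintro ⟨h1, h2⟩; constructor <;> linarith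

/-- The truncation `Σ_{k=1}^{N} a_k 𝟙_{(1/(k+1),1/k]}` is the step function of the truncated
sequence: on `(0,1]`, `Σ_{k=1}^N a_k 𝟙_{(1/(k+1),1/k]}(x) = (𝟙_{n ≤ N} a)(⌊1/x⌋)`.
[cite: Bagchi2006, §3 proof of Theorem 1 (U f = (f(1/n))_n)] -/
theorem sum_indicator_cell_eq {a : ℕ → ℂ} {N : ℕ} {x : ℝ} (hx : x ∈ Ioc (0 : ℝ) 1) :
    ∑ k ∈ Finset.Icc 1 N, a k * (Ioc (1 / ((k : ℝ) + 1)) (1 / (k : ℝ))).indicator (fun _ ↦ (1 : ℂ)) x =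
      ({n : ℕ | n ≤ N}.indicator a) ⌊1 / x⌋₊ := by
  have hfl : 0 < ⌊1 / x⌋₊ := by
    rw [Nat.floor_pos, le_div_iff₀ hx.1]; linarith [hx.2]
  have hterm : ∀ k ∈ Finset.Icc 1 N,
      a k * (Ioc (1 / ((k : ℝ) + 1)) (1 / (k : ℝ))).indicator (fun _ ↦ (1 : ℂ)) x =
        if ⌊1 / x⌋₊ = k then a k else 0 := by
    intro k hk
    have hk1 : 0 < k := (Finset.mem_Icc.1 hk).1
    by_cases h : ⌊1 / x⌋₊ = k
    · rw [if_pos h, indicator_of_mem ((mem_cell_iff_natFloor_eq hx.1 hk1).2 h), mul_one]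
    · rw [if_neg h, indicator_of_notMem (fun hm ↦ h ((mem_cell_iff_natFloor_eq hx.1 hk1).1 hm)),
        mul_zero]
  rw [Finset.sum_congr rfl hterm, Finset.sum_ite_eq]
  by_cases hN : ⌊1 / x⌋₊ ≤ N
  · rw [if_pos (Finset.mem_Icc.2 ⟨hfl, hN⟩), Set.indicator_of_mem (show ⌊1 / x⌋₊ ∈ {n | n ≤ N} from hN)]
  · rw [if_neg (fun h ↦ hN (Finset.mem_Icc.1 h).2),
      Set.indicator_of_notMem (show ⌊1 / x⌋₊ ∉ {n | n ≤ N} from hN)]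

/-- Every truncated sequence `𝟙_{n ≤ N} a` is approximable in `𝓗` once `𝟏 ∈ 𝓚`.
[cite: Bagchi2006, §3 proof of Theorems 8 and 1] -/
theorem bagchiSpanApprox_truncation (hone : BagchiGSpanApprox fun _ : ℝ ↦ (1 : ℂ)) (a : ℕ → ℂ)
    (N : ℕ) : BagchiSpanApprox ({n : ℕ | n ≤ N}.indicator a) := by
  -- the finite sum of cells is approximable in `L²((0,1])`
  have hsum : BagchiGSpanApprox (fun x ↦ ∑ k ∈ Finset.Icc 1 N,
      a k * (Ioc (1 / ((k : ℝ) + 1)) (1 / (k : ℝ))).indicator (fun _ ↦ (1 : ℂ)) x) := by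
    refine BagchiGSpanApprox.finset_sum _ _ (fun k hk ↦ ?_) (fun k hk ↦ ?_)
    · exact (hone.indicator_cell (Finset.mem_Icc.1 hk).1).smul (a k)
    · exact ((aestronglyMeasurable_const (b := (1 : ℂ))).indicator measurableSet_Ioc).const_mul _
  -- it is the step function of the truncated sequence
  have hstep : BagchiGSpanApprox (fun x ↦ ({n : ℕ | n ≤ N}.indicator a) ⌊1 / x⌋₊) := by
    refine hsum.congr_ae ?_
    filter_upwards [ae_restrict_mem measurableSet_Ioc] with x hx
    exact sum_indicator_cell_eq hx
  -- transport by `U`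
  intro ε hε
  obtain ⟨M, l, c, hl, hlt⟩ := hstep ε hε
  refine ⟨M, l, c, hl, ?_⟩
  rw [← eLpNorm_sub_sum_bagchiG_eq l c hl]
  exact hlt

/-- The span of the `γ_l` in `𝓗` is closed (sequence-space analogue of
`BagchiGSpanApprox.of_forall_exists`). [cite: Bagchi2006, §1 (closed linear span)] -/
theorem BagchiSpanApprox.of_forall_exists {a : ℕ → ℂ}
    (h : ∀ η : ℝ, 0 < η → ∃ b : ℕ → ℂ, BagchiSpanApprox b ∧
      eLpNorm (fun n ↦ a n - b n) 2 bagchiMeasure ≤ ENNReal.ofReal η) :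
    BagchiSpanApprox a := by
  intro ε hε
  obtain ⟨b, hb, hab⟩ := h (ε / 2) (half_pos hε)
  obtain ⟨N, l, c, hl, hF⟩ := hb (ε / 2) (half_pos hε)
  refine ⟨N, l, c, hl, ?_⟩
  have heq : (fun n ↦ a n - ∑ i, c i * (bagchiGamma (l i) n : ℂ)) =
      (fun n ↦ a n - b n) + fun n ↦ b n - ∑ i, c i * (bagchiGamma (l i) n : ℂ) := by
    funext n; simp only [Pi.add_apply]; ring
  rw [heq]
  calc eLpNorm ((fun n ↦ a n - b n) + fun n ↦ b n - ∑ i, c i * (bagchiGamma (l i) n : ℂ)) 2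
          bagchiMeasure
      ≤ eLpNorm (fun n ↦ a n - b n) 2 bagchiMeasure +
          eLpNorm (fun n ↦ b n - ∑ i, c i * (bagchiGamma (l i) n : ℂ)) 2 bagchiMeasure :=
        eLpNorm_add_le (measurable_from_nat.aestronglyMeasurable)
          (measurable_from_nat.aestronglyMeasurable) one_le_two
    _ < ENNReal.ofReal (ε / 2) + ENNReal.ofReal (ε / 2) := ENNReal.add_lt_add_of_le_of_lt
        (ne_top_of_le_ne_top ENNReal.ofReal_ne_top hab) hab hF
    _ = ENNReal.ofReal ε := by
        rw [← ENNReal.ofReal_add (half_pos hε).le (half_pos hε).le, add_halves]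

/-- The tails `{n > N}` of `𝓗`'s measure shrink to zero. [cite: Bagchi2006, §1 (𝓗 is a weighted l² space)] -/
theorem tendsto_bagchiMeasure_tail :
    Tendsto (fun N : ℕ ↦ bagchiMeasure {n : ℕ | N < n}) atTop (nhds 0) := by
  have hanti : Antitone fun N : ℕ ↦ {n : ℕ | N < n} :=
    fun N M hNM n (hn : M < n) ↦ lt_of_le_of_lt hNM hn
  have h := tendsto_measure_iInter_atTop (μ := bagchiMeasure)
    (fun N ↦ ((Set.to_countable {n : ℕ | N < n}).measurableSet).nullMeasurableSet) hanti
    ⟨0, (measure_lt_top_of_subset (Set.subset_univ _) bagchiMeasure_univ_lt_top.ne).ne⟩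
  have hempty : (⋂ N : ℕ, {n : ℕ | N < n}) = ∅ :=
    Set.eq_empty_iff_forall_notMem.2 fun n hn ↦ lt_irrefl n (Set.mem_iInter.1 hn n)
  rwa [hempty, measure_empty] at h

/-- **Theorem 1, (ii) ⟹ (iii)** — PROVED (Bagchi's semigroup argument, transported by `U`): if `γ`
(equivalently `𝟏 ∈ L²((0,1])`) is in the closed span, then `{γ_l}` is total in `𝓗`.
[cite: Bagchi2006, Theorem 1 (ii) ⟹ (iii); §3 proof of Theorem 8] -/
theorem bagchi_total_of_spanApprox_one (hone : BagchiSpanApprox fun _ : ℕ ↦ (1 : ℂ))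
    (a : ℕ → ℂ) (ha : MemLp a 2 bagchiMeasure) : BagchiSpanApprox a := by
  -- `𝟏 ∈ 𝓚` in function space
  have hone' : BagchiGSpanApprox fun _ : ℝ ↦ (1 : ℂ) := by
    intro ε hε
    obtain ⟨N, l, c, hl, hlt⟩ := hone ε hε
    refine ⟨N, l, c, hl, ?_⟩
    rw [← eLpNorm_sub_sum_bagchiG_eq l c hl (fun _ ↦ (1 : ℂ))] at hlt
    exact hlt
  refine BagchiSpanApprox.of_forall_exists fun η hη ↦ ?_
  -- uniform integrability: small tails of `a`
  obtain ⟨δ, hδ, hδN⟩ := ha.eLpNorm_indicator_le one_le_two ENNReal.ofNat_ne_top hη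
  obtain ⟨N, hN⟩ : ∃ N : ℕ, bagchiMeasure {n : ℕ | N < n} ≤ ENNReal.ofReal δ := by
    have := (tendsto_order.1 tendsto_bagchiMeasure_tail).2 (ENNReal.ofReal δ)
      (ENNReal.ofReal_pos.2 hδ)
    obtain ⟨N, hN⟩ := this.exists
    exact ⟨N, hN.le⟩
  refine ⟨{n : ℕ | n ≤ N}.indicator a, bagchiSpanApprox_truncation hone' a N, ?_⟩
  have heq : (fun n ↦ a n - {n : ℕ | n ≤ N}.indicator a n) = {n : ℕ | N < n}.indicator a := by
    funext n
    by_cases hn : n ≤ N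
    · rw [Set.indicator_of_mem (show n ∈ {n | n ≤ N} from hn),
        Set.indicator_of_notMem (show n ∉ {n | N < n} from not_lt.2 hn), sub_self]
    · rw [Set.indicator_of_notMem (show n ∉ {n | n ≤ N} from hn),
        Set.indicator_of_mem (show n ∈ {n | N < n} from not_le.1 hn), sub_zero]
  rw [heq]
  exact hδN _ (Set.to_countable _).measurableSet hN

/-- A function of `𝓜` is, a.e. on `(0,1]`, the step function `x ↦ a(⌊1/x⌋)` of its value sequence
(`U f = (f(1/n))_n`). [cite: Bagchi2006, §3 ("we may (and do) think of 𝓜 as the space of all such (genuine) piece-wise constant functions")] -/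
theorem IsBagchiStep.exists_ae_eq_comp_floor {f : ℝ → ℂ} (hf : IsBagchiStep f) :
    ∃ a : ℕ → ℂ, f =ᵐ[volume.restrict (Ioc (0 : ℝ) 1)] fun x ↦ a ⌊1 / x⌋₊ := by
  choose! a ha using hf
  refine ⟨a, ?_⟩
  rw [← iUnion_Ioc_one_div_succ]
  show ∀ᵐ x ∂(volume.restrict (⋃ n : ℕ, Ioc (1 / ((n : ℝ) + 2)) (1 / ((n : ℝ) + 1)))),
    f x = a ⌊1 / x⌋₊
  rw [ae_restrict_iUnion_iff]
  intro m
  have hm := ha (m + 1) (Nat.succ_pos m)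
  have hset : Ioc (1 / (((m + 1 : ℕ) : ℝ) + 1)) (1 / ((m + 1 : ℕ) : ℝ)) =
      Ioc (1 / ((m : ℝ) + 2)) (1 / ((m : ℝ) + 1)) := by
    push_cast
    rw [show (m : ℝ) + 1 + 1 = (m : ℝ) + 2 by ring]
  rw [hset] at hm
  filter_upwards [hm, ae_restrict_mem measurableSet_Ioc] with x hx hmem
  rw [hx, natFloor_one_div_eq_of_mem hmem]

/-- **Theorem 8, (ii) ⟹ (iii)** — PROVED: if `𝟏` is in the closed span of the `g_l`, then `{g_l}` is
total in `𝓜` (via `U`, Theorem 1 (ii) ⟹ (iii), and `U⁻¹`). [cite: Bagchi2006, Theorem 8 (ii) ⟹ (iii)] -/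
theorem bagchiG_total_of_spanApprox_one (hone : BagchiGSpanApprox fun _ : ℝ ↦ (1 : ℂ))
    (f : ℝ → ℂ) (hf : MemLp f 2 (volume.restrict (Ioc (0 : ℝ) 1))) (hstep : IsBagchiStep f) :
    BagchiGSpanApprox f := by
  obtain ⟨a, hfa⟩ := hstep.exists_ae_eq_comp_floor
  have ha : MemLp a 2 bagchiMeasure := by
    refine ⟨measurable_from_nat.aestronglyMeasurable, ?_⟩
    rw [← eLpNorm_comp_floor_eq, ← eLpNorm_congr_ae hfa]
    exact hf.eLpNorm_lt_top
  have hone' : BagchiSpanApprox fun _ : ℕ ↦ (1 : ℂ) := by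
    intro ε hε
    obtain ⟨N, l, c, hl, hlt⟩ := hone ε hε
    exact ⟨N, l, c, hl, by rwa [← eLpNorm_sub_sum_bagchiG_eq l c hl (fun _ ↦ (1 : ℂ))]⟩
  have hA := bagchi_total_of_spanApprox_one hone' a ha
  have hstepA : BagchiGSpanApprox (fun x ↦ a ⌊1 / x⌋₊) := by
    intro ε hε
    obtain ⟨N, l, c, hl, hlt⟩ := hA ε hε
    exact ⟨N, l, c, hl, by rwa [eLpNorm_sub_sum_bagchiG_eq l c hl a]⟩
  exact hstepA.congr_ae hfa.symm

/-! ### The printed theorems, discharged -/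

/-- DISCHARGE of `Bagchi2006_thm_1`: **Bagchi's Theorem 1 holds** — RH ⟺ `γ ∈` closed span of the
`γ_l` ⟺ `{γ_l}` total in `𝓗`, proved as a three-way equivalence (no side asserted).
[cite: Bagchi2006, Theorem 1] [cite: Broughan2017, Vol. 2 §3.4 p. 36] -/
theorem Bagchi2006_thm_1_holds : Bagchi2006_thm_1 := by
  unfold Bagchi2006_thm_1
  tfae_have 1 ↔ 2 := riemannHypothesis_iff_bagchiSpanApprox_one
  tfae_have 2 → 3 := fun h a ha ↦ bagchi_total_of_spanApprox_one h a ha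
  tfae_have 3 → 1 := riemannHypothesis_of_bagchi_total
  tfae_finish

/-- DISCHARGE of `Bagchi2006_thm_8`: **Bagchi's Theorem 8 (Báez-Duarte's refinement of
Beurling–Nyman) holds** — RH ⟺ `𝟏 ∈` closed span of the `g_l` in `L²((0,1])` ⟺ `{g_l}` total in
`𝓜`. [cite: Bagchi2006, Theorem 8] [cite: Broughan2017, Vol. 2 §3.4 pp. 35–36] -/
theorem Bagchi2006_thm_8_holds : Bagchi2006_thm_8 := by
  unfold Bagchi2006_thm_8
  tfae_have 1 ↔ 2 := riemannHypothesis_iff_bagchiGSpanApprox_one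
  tfae_have 2 → 3 := fun h f hf hs ↦ bagchiG_total_of_spanApprox_one h f hf hs
  tfae_have 3 → 1 := riemannHypothesis_of_bagchiG_total
  tfae_finish

/-- RH ⟺ `{γ_l = ({n/l})_n : l ≥ 1}` is total in Bagchi's `𝓗` (Theorem 1 (i) ⟺ (iii), PROVED; Bagchi:
"the Riemann hypothesis as a version of the central theme of harmonic analysis: that more or less
arbitrary sequences … can be arbitrarily well approximated by superpositions of … the sequences
`γ_l`"). [cite: Bagchi2006, Theorem 1 (i) ⟺ (iii)] -/
theorem riemannHypothesis_iff_bagchiGamma_total :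
    RiemannHypothesis ↔ ∀ a : ℕ → ℂ, MemLp a 2 bagchiMeasure → BagchiSpanApprox a :=
  Bagchi2006_thm_1_holds.out 0 2

/-- RH ⟺ `{g_l}` is total in `𝓜` (Theorem 8 (i) ⟺ (iii), PROVED). [cite: Bagchi2006, Theorem 8 (i) ⟺ (iii)] -/
theorem riemannHypothesis_iff_bagchiG_total :
    RiemannHypothesis ↔ ∀ f : ℝ → ℂ, MemLp f 2 (volume.restrict (Ioc (0 : ℝ) 1)) →
      IsBagchiStep f → BagchiGSpanApprox f :=
  Bagchi2006_thm_8_holds.out 0 2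

end Literature.NumberTheory.LFunctions
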